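import Mathlib.Analysis.Complex.Schwarz

/-!
# T⁴ programme, spine node NE1′ (O3b/H2), COUPLING LINE — leaf L6 (S)+(A) of the skeleton
# `t4/skeletons/NE1p-t4-ne1p-p3.md` (v0.5) as ONE abstract lemma: an EQUIVARIANT map that is complex-analytic and bounded on a
# ball about a FIXED POINT of the symmetry vanishes there and is small LINEARLY in the distance to it (Schur + Schwarz)

Cell `pub-balaban`, unit `b2b-balaban-t4-ne1p-p3` (ROUND-2 technique-distinct prover #3 on BINDER row NE1′, technique «coupling of
block-spin towers»), generation 29.  This file is OUR elementary lemma (new work ⇒ `Summits/`), not a published statement.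

HONEST FRAMING (T4-DAG p. 1).  Rung (B)+1 on ONE finite four-torus of fixed physical size; NOT infinite volume, NOT a mass gap,
NOT the Clay problem, NOT summit progress.  Nothing of T. Bałaban's series is asserted or cited as a fact here: the lemma is pure
complex analysis + linear algebra over Mathlib, and its USE — «the conditional mean of an `Ad`-equivariant `𝔤`-valued functional
of the fine fields given the local background is an equivariant, complex-analytic, bounded function of the background on the
printed analyticity ball ([Balaban1988Convergent] (2.28) p. 259 radii), the flat background is a fixed point of the global gauge
rotations, a compact semisimple `𝔤` has no non-zero `Ad`-invariant vector ⇒ the conditional mean is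
`≤ (bound / radius) · (deviation of the background from flat)`» — is the skeleton's leaf L6 (S)+(A), a HYPOTHESIS-SHAPED reading
whose analytic inputs (analyticity, the bound, the deviation) are NOT supplied here.  HONEST DEPENDENCY: continuum YM on T⁴ ⇐
BetaPertH ∧ nine spine estimates (0/9 proved); BetaPertH ⇐ (D1) ∧ (D4) ∧ CAP+tail; G-an2-4 gates asym, D1 and NE2/3/4.

WHAT IS PROVED ([folklore], Mathlib only).
* `apply_eq_zero_of_equivariant_of_fixed` — (S) SCHUR AT A FIXED POINT: if `m (σ i b) = π i (m b)` for all `i, b`, the point `c`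
  is fixed by every `σ i`, and the only vector fixed by every `π i` is `0`, then `m c = 0`.
* `norm_le_div_mul_norm_sub_of_equivariant` — (S)+(A): if moreover `m` is complex-differentiable on `ball c R₁` and bounded by
  `R₂` there, then `‖m z‖ ≤ (R₂ / R₁) · ‖z − c‖` on that ball (Mathlib's Schwarz lemma `Complex.dist_le_div_mul_dist_of_mapsTo_ball`
  for maps between complex normed spaces).
* `norm_le_div_mul_of_equivariant` — the same with an explicit deviation bound `‖z − c‖ ≤ δ`: `‖m z‖ ≤ (R₂ / R₁) · δ`.
NOT PROVED, NOT CLAIMED: anything about Bałaban's densities, conditional laws, radii or backgrounds; the skeleton's leaf L6 (G)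
([Balaban1987RG1] (1.17) p. 263, the `L^{−2n}` smoothness of backgrounds) and L6 (I) (cross-scale anisotropy, NOT in print) are
what turn this lemma into an estimate, and they are not here.
-/

namespace Summit.QuantumFields.BalabanUV.T4Continuum.NE1pEquivariantSchwarz

open Metric Set

variable {E F : Type*} [NormedAddCommGroup E] [NormedSpace ℂ E] [NormedAddCommGroup F] [NormedSpace ℂ F]
variable {ι : Type*} {σ : ι → E → E} {π : ι → F → F} {m : E → F} {c : E}

omit [NormedAddCommGroup E] [NormedSpace ℂ E] [NormedSpace ℂ F] in
/-- **(S) SCHUR AT A FIXED POINT.**  An equivariant map (`m ∘ σ i = π i ∘ m`) takes a point fixed by every `σ i` to a vector fixed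
by every `π i`; if `0` is the only such vector, the value is `0`.  (Use: `π i = Ad gᵢ` on a compact semisimple Lie algebra,
`σ i` = the global gauge rotation of the background, `c` = the flat background.) [folklore] -/
theorem apply_eq_zero_of_equivariant_of_fixed (hfix : ∀ v : F, (∀ i, π i v = v) → v = 0)
    (hequiv : ∀ i b, m (σ i b) = π i (m b)) (hc : ∀ i, σ i c = c) : m c = 0 :=
  hfix (m c) fun i => by rw [← hequiv i c, hc i]

/-- **(S)+(A) EQUIVARIANCE + SCHWARZ.**  An equivariant map, complex-differentiable on `ball c R₁` about a fixed point `c` of the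
symmetry and bounded by `R₂` there, satisfies `‖m z‖ ≤ (R₂ / R₁) · ‖z − c‖` on the ball: it vanishes at `c` by (S) and Mathlib's
Schwarz lemma for maps between complex normed spaces does the rest.  (Use: `R₁` = a printed analyticity radius of the background
chart, `R₂` = the sup of the functional, `‖z − c‖` = the deviation of the local background from flat.) [folklore] -/
theorem norm_le_div_mul_norm_sub_of_equivariant {R₁ R₂ : ℝ} (hfix : ∀ v : F, (∀ i, π i v = v) → v = 0)
    (hequiv : ∀ i b, m (σ i b) = π i (m b)) (hc : ∀ i, σ i c = c)
    (hd : DifferentiableOn ℂ m (ball c R₁)) (hbd : ∀ b ∈ ball c R₁, ‖m b‖ ≤ R₂) {z : E} (hz : z ∈ ball c R₁) :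
    ‖m z‖ ≤ R₂ / R₁ * ‖z - c‖ := by
  have h0 : m c = 0 := apply_eq_zero_of_equivariant_of_fixed hfix hequiv hc
  have hmaps : MapsTo m (ball c R₁) (closedBall (m c) R₂) := by
    intro b hb
    rw [mem_closedBall, h0, dist_zero_right]
    exact hbd b hb
  have h := Complex.dist_le_div_mul_dist_of_mapsTo_ball hd hmaps hz
  rwa [h0, dist_zero_right, dist_eq_norm] at h

/-- The same with an explicit deviation bound: `‖z − c‖ ≤ δ` (and `0 ≤ R₂`, `0 < R₁`) give `‖m z‖ ≤ (R₂ / R₁) · δ`. [folklore] -/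
theorem norm_le_div_mul_of_equivariant {R₁ R₂ δ : ℝ} (hfix : ∀ v : F, (∀ i, π i v = v) → v = 0)
    (hequiv : ∀ i b, m (σ i b) = π i (m b)) (hc : ∀ i, σ i c = c)
    (hd : DifferentiableOn ℂ m (ball c R₁)) (hbd : ∀ b ∈ ball c R₁, ‖m b‖ ≤ R₂) (hR₁ : 0 < R₁) (hR₂ : 0 ≤ R₂)
    {z : E} (hz : z ∈ ball c R₁) (hδ : ‖z - c‖ ≤ δ) :
    ‖m z‖ ≤ R₂ / R₁ * δ :=
  (norm_le_div_mul_norm_sub_of_equivariant hfix hequiv hc hd hbd hz).trans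
    (mul_le_mul_of_nonneg_left hδ (div_nonneg hR₂ hR₁.le))

end Summit.QuantumFields.BalabanUV.T4Continuum.NE1pEquivariantSchwarz
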